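import Literature.Probability.RandomPlanarGeometry.SAWFiniteMemoryKernelSymmK16
import HarnessLib

/-!
# `μ(ℤ²) ≤ 2.695` and `μ(ℤ²) ≤ 2.7` with STANDARD axioms (twins of the `native_decide` theorems of `SAWFiniteMemory16.lean`)

Topic `Literature/Probability/RandomPlanarGeometry`. Theorem-only file. `SAWFiniteMemory16.lean` proves `connectiveConstant_le_2695`
(`μ(ℤ²) ≤ 2.695`) and `connectiveConstant_le_27` (`μ(ℤ²) ≤ 2.7`, the upper half of Lawler–Schramm–Werner's "rigorously … between 2.6
and 2.7") from ONE `native_decide` evaluation of the unreduced memory-16 Pönitz–Tittmann certificate (`467 249` states; tier CHECKED-native).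
The symmetry-reduced certificate of the same automaton is now checked BY THE KERNEL (`SAWFiniteMemoryKernelSymmK16.lean`,
`FiniteMemory.connectiveConstant_le_26939 : μ(ℤ²) ≤ 2.6939`, `58 411` orbit representatives, axioms `propext`/`Classical.choice`/`Quot.sound`),
so both statements hold with standard axioms; the `_std` names are their statement-identical standard-axiom twins, for consumers
that want to drop `Lean.ofReduceBool` (e.g. the upper halves of `SelfAvoidingWalkCert.lean` and `SAWSharpFugacity.lean`).

## References

* [PonitzTittmann2000] A. Pönitz, P. Tittmann, Electron. J. Combin. 7 (2000) R21, §3 and Table 2 (`d = 2`, `k = 16`: `2.6939`).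
* [LawlerSchrammWerner2004SAW] G. F. Lawler, O. Schramm, W. Werner, Proc. Sympos. Pure Math. 72 (2004), §3.1.
-/

namespace Literature.Probability.RandomPlanarGeometry.SAW

/-- **`μ(ℤ²) ≤ 2.695`** with STANDARD axioms (from the kernel-checked `μ(ℤ²) ≤ 2.6939`); statement-identical twin of the
CHECKED-native `connectiveConstant_le_2695`. [cite: PonitzTittmann2000, Table 2 (d = 2, k = 16: 2.6939)] -/
theorem connectiveConstant_le_2695_std : connectiveConstant ≤ 2.695 :=
  FiniteMemory.connectiveConstant_le_26939.trans (by norm_num)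

/-- **`μ(ℤ²) ≤ 2.7`** with STANDARD axioms, the upper half of "rigorously it is known to be between 2.6 and 2.7";
statement-identical twin of the CHECKED-native `connectiveConstant_le_27`. [cite: LawlerSchrammWerner2004SAW, §3.1] -/
theorem connectiveConstant_le_27_std : connectiveConstant ≤ 2.7 :=
  FiniteMemory.connectiveConstant_le_26939.trans (by norm_num)

end Literature.Probability.RandomPlanarGeometry.SAW
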